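import Summits.QuantumFields.BalabanUV.T4Continuum.Support.SmallFieldDomains

/-!
# T⁴ programme, SUBSTRATE — `Support/SmallFieldDomainsCubes`, part 2/3 of `Support/SmallFieldDomains`: the two PRINTED CLASSES OF CUBES
# ([Balaban1985BackgroundPropagators] p. 396, [Balaban1985Variational] pp. 278–279) on `ℤ^d`, the UNIQUENESS of the
# [B9] index, and the interior / collar [B11] class cubes about a point
# (v1.1, APPEND-ONLY: §3′ `IsClassCube396` = the [B9] class with the PRINTED «O(1) ≧ 10»; §3's `IsClassCubeB9` deprecated)

CITATION HEADER (lean-in-tree rule 2026-08-18).  Sources (papers UNDER ADJUDICATION by the audit cell `pub-balaban`;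
nothing of them is asserted — this module DEFINES concrete `ℤ^d` readings of three printed geometric notions and PROVES
elementary facts about the definitions):
* [Balaban1985RegularSpaces] T. Bałaban, *Spaces of regular gauge field configurations on a lattice and gauge fixing
  conditions*, Commun. Math. Phys. **99** (1985) 75–102 (cell paper B8; journal page = PDF page + 74), p. 77 (1.3)–(1.5):
  *"Ω₀ ⊃ Ω₁ ⊃ Ω₂ ⊃ … ⊃ Ω_k, Ω_j ⊂ T_η (1.3) … Ω_j = B^j(Ω_j^{(j)}), Ω_j is a sum of cubes of a size M₁L^jη,
  (L^jη)^{-1} dist(Ω_j^c, Ω_{j+1}) > RM₁. (1.4)"* — typed in `…B8ConstraintBonds` as `DomainSeq` with the WEAK radius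
  `L^{j+1}`; here the printed radii are kept (`BigDomainSeq`, §1) and the bridge to `DomainSeq` is proved.
* [Balaban1985BackgroundPropagators] T. Bałaban, *Propagators for lattice gauge theories in a background field*, Commun.
  Math. Phys. **99** (1985) 389–434 (cell paper B9; journal page = PDF page + 388), p. 396 [PDF 8], read on the held text
  `paper:balaban1985-cmp99-background-propagators` p. 8: *"At first let us introduce a class of cubes. For each cube □ of
  this class there exists a unique index j, 0 ≤ j ≤ k, such that □ ⊂ B^j(Λ_j) ∪ B^{j+1}(Λ_{j+1}), □ ∩ B^j(Λ_j) ≠ ∅, and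
  □ is a union of several big blocks of the lattice T_{L−j} [sic], which implies that its size in the lattice T_η is
  O(1)ML^jη. Here O(1) will mean a number ≧ 10."* («≧» per the render p008, XREAD F-ne9leaf09g10-1; v1 had the OCR's «≤»; p. 409:
  *"the number O(1) in the condition (3.35) can be taken as equal to 12"*) (§3′ `IsClassCube396`; §3 `IsClassCubeB9` deprecated).
* [Balaban1985Variational] T. Bałaban, *The variational problem and background fields in renormalization group method
  for lattice gauge theories*, Commun. Math. Phys. **102** (1985) 277–309 (cell paper B11; journal page = PDF page +
  276), pp. 278–279 [PDF 2–3], read on the held text `paper:balaban1985-cmp102-variational-background` pp. 2–3: *"To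
  formulate them we have to introduce a class of cubes. This class was described in Sect. F [6]. Each cube □ of this
  class is contained in B^j(Λ_j) ∪ B^{j+1}(Λ_{j+1}) = Ω_j∖Ω_{j+2} for some j between 0 and k, and is a union of big
  blocks of the L^{-j}-lattice. More exactly we assume that □ has a size 2ML^jη, where M is a multiple of R₁M₁, and
  that the cube □̃ of the size (2M + 4R₁M₁)L^jη and with the same center as □, is contained in B^j(Λ_j) ∪
  B^{j+1}(Λ_{j+1}), but not in B^{j+1}(Λ_{j+1}). We consider all cubes □ satisfying the above conditions."* (§4:
  `IsClassCubeB11`).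


CONTENT (same namespace as part 1; audit cell `pub-balaban`, SUBSTRATE cell seat p4; `substrate/SUBSTRATE-MAP.md` §p4):
 * §3 (v1; DEPRECATED, kept byte-identical) `IsClassCubeB9` (`1 ≤ nblk ≤ 10` — OCR direction; print «≧ 10»), `…index_unique`,
   `bigBlock_isClassCubeB9`; §3′ (v1.1) **`IsClassCube396`** = the [B9] p. 396 class AS PRINTED (`ten_le : 10 ≤ nblk`) +
   **`IsClassCube396.index_unique`** (PROVED; block count irrelevant); no covering lemma for the [B9] class is claimed here;
 * §4 the [B11] class `IsClassCubeB11 L M₁ R₁ k Ω j c M` (centre `c` on the `M₁L^j`-lattice, `R₁M₁ ∣ M`, `□ = ccube c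
   (ML^j)`, `□̃ = ccube c ((M+2R₁M₁)L^j) ⊂ Ω_j ∖ Ω_{j+2}`, `□̃ ⊄ Ω_{j+1}`), its [B9]-type clause `enl_meets_layer`, and the
   two regimes of the covering under `12(R₁+1)L ≤ R`: **`interior_classCubeB11`** (the `□̃` of the natural index-`j`
   cube of size parameter `2R₁M₁` about the corner of `x`'s big block fits in `Ω_j` ⇒ class cube, `x` is `M₁L^j`-deep)
   and **`collar_classCubeB11`** (it does not ⇒ the printed clause «not contained in B^{j+1}(Λ_{j+1})» forces the LOWER
   index `j−1` and the size parameter `5L·R₁M₁`; class cube by the separations at levels `j−1` and `j`, `x` is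
   `M₁L^{j−1}`-deep).  Part 3 (`Support/SmallFieldDomainsCover`) packages them.
HONEST FRAMING (T4-DAG p. 1).  Region BOOKKEEPING on `ℤ^d` (universal cover of the torus), fine-lattice units `η = 1`; no
configuration, no estimate, no torus identification; the printed sentences quoted above are DOCUMENTATION of what the three
hypothesis SHAPES read (bracketed keys are CONTEXT, not cite tags) — nothing printed is asserted, no `def … : Prop` fact is minted;
PLACEMENT: the cell's own bookkeeping mathematics ⇒ `Summits/…/T4Continuum/Support/` (gate `lint.literature-cited-only`),
importing the `Literature.…Balaban1983to89.*` geometry modules (allowed direction).  NOT NE2/NE3/NE7 content; spine 0/9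
unchanged; NOT infinite volume, NOT a mass gap, NOT Clay.  HONEST DEPENDENCY: continuum YM on T⁴ ⇐ BetaPertH ∧ nine spine
estimates (0/9 proved); BetaPertH ⇐ (D1) ∧ (D4) ∧ CAP+tail; G-an2-4 gates asym, D1 and NE2/3/4.  No `sorry`.
-/

namespace Summit.QuantumFields.BalabanUV.T4Continuum.SmallFieldDomains

open Literature.MathematicalPhysics.QuantumFieldTheory.Balaban1983to89.B14DomainGeom
open Literature.MathematicalPhysics.QuantumFieldTheory.Balaban1983to89.B8ConstraintBonds (IsLevel Lam DomainSeq)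
open Literature.MathematicalPhysics.QuantumLattice (blockMap blockBase)

variable {d : ℕ}

/-! ## §3 The [B9] class of cubes (p. 396) and the uniqueness of its index -/

/-- The corner box of side `n` at `a`: `{y | a_i ≤ y_i < a_i + n}`. [folklore] -/
def cbox (a : Pt d) (n : ℤ) : Set (Pt d) := {y | ∀ i, a i ≤ y i ∧ y i < a i + n}

/-- The partition cube of index `b` is the corner box at `s·b` of side `s`. [folklore] -/
theorem pcube_eq_cbox (s : ℕ) (hs : 0 < s) (b : Pt d) : pcube s b = cbox (fun i => (s : ℤ) * b i) s := by
  ext y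
  constructor
  · intro hy i
    have h1 := cubeIdx_le s hs y i
    have h2 := lt_cubeIdx s hs y i
    have hb : cubeIdx s y = b := hy
    rw [hb] at h1 h2
    exact ⟨h1, h2⟩
  · intro hy
    exact cubeIdx_eq_of_mem s hs y b hy

/-- **THE [B9] CLASS OF CUBES, p. 396** (fine units; `M₁` = the big-block factor, there called `M`): a cube of INDEX
`j ≤ k`, given by its lower corner `a` on the `M₁L^j`-lattice and its side `nblk·M₁L^j` with `1 ≤ nblk ≤ 10` big blocks
(*"□ is a union of several big blocks of the lattice T_{L^jη}, which implies that its size in the lattice T_η is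
O(1)ML^jη. Here O(1) will mean a number ≤ 10"*), such that *"□ ⊂ B^j(Λ_j) ∪ B^{j+1}(Λ_{j+1})"* (`= Ω_j ∖ Ω_{j+2}`) and
*"□ ∩ B^j(Λ_j) ≠ ∅"*.  (The special reading of `Λ₀` on p. 396 is not typed.)  Typed READING of [Balaban1985BackgroundPropagators]
p. 396 (the class of cubes); hypothesis shape, asserted of nothing. [folklore] -/
structure IsClassCubeB9 (L M₁ k : ℕ) (Ω : ℕ → Set (Pt d)) (j : ℕ) (a : Pt d) (nblk : ℕ) : Prop where
  /-- the index is at most `k` -/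
  index_le : j ≤ k
  /-- between one and ten big blocks per side -/
  one_le : 1 ≤ nblk
  /-- `O(1) ≤ 10` -/
  le_ten : nblk ≤ 10
  /-- the corner lies on the big-block lattice of level `j` -/
  corner_dvd : ∀ i, ((M₁ * L ^ j : ℕ) : ℤ) ∣ a i
  /-- `□ ⊂ B^j(Λ_j) ∪ B^{j+1}(Λ_{j+1}) = Ω_j ∖ Ω_{j+2}` -/
  subset : cbox a ((nblk * (M₁ * L ^ j) : ℕ) : ℤ) ⊆ Ω j \ Ω (j + 2)
  /-- `□ ∩ B^j(Λ_j) ≠ ∅` -/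
  meets : (cbox a ((nblk * (M₁ * L ^ j) : ℕ) : ℤ) ∩ layer Ω j).Nonempty

/-- **UNIQUENESS OF THE INDEX** (asserted on p. 396: *"there exists a unique index j"*; proved): two [B9] descriptions
of the SAME point set have the same index — if `j' < j`, a point of `□ ∩ (Ω_{j'} ∖ Ω_{j'+1})` is outside
`Ω_{j'+1} ⊇ Ω_j ⊇ □`. [folklore] -/
theorem IsClassCubeB9.index_unique {L M₁ R k : ℕ} {Ω : ℕ → Set (Pt d)} (hΩ : BigDomainSeq L M₁ R k Ω)
    {j j' : ℕ} {a a' : Pt d} {n n' : ℕ} (hc : IsClassCubeB9 L M₁ k Ω j a n) (hc' : IsClassCubeB9 L M₁ k Ω j' a' n')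
    (heq : cbox a ((n * (M₁ * L ^ j) : ℕ) : ℤ) = cbox a' ((n' * (M₁ * L ^ j') : ℕ) : ℤ)) : j = j' := by
  by_contra hne
  rcases Nat.lt_or_gt_of_ne hne with hlt | hlt
  · -- `j < j'`: a point of `□ ∩ layer j` is not in `Ω (j+1) ⊇ Ω j' ⊇ □'`
    obtain ⟨y, hy, hyl⟩ := hc.meets
    have hy' : y ∈ Ω j' := by
      rw [heq] at hy
      exact (hc'.subset hy).1
    exact hyl.2 (hΩ.anti_le (Nat.succ_le_of_lt hlt) hy')
  · obtain ⟨y, hy, hyl⟩ := hc'.meets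
    have hy' : y ∈ Ω j := by
      rw [← heq] at hy
      exact (hc.subset hy).1
    exact hyl.2 (hΩ.anti_le (Nat.succ_le_of_lt hlt) hy')

/-- **Every point of the layer `Ω_j ∖ Ω_{j+1}` lies in a [B9] class cube of index `j`: its own big block**
(`nblk = 1`; the block is in `Ω_j` because `Ω_j` is a union of big blocks, and misses `Ω_{j+1}` because `Ω_{j+1}` is one
too and misses the point). [folklore] -/
theorem bigBlock_isClassCubeB9 {L M₁ R k : ℕ} {Ω : ℕ → Set (Pt d)} (hΩ : BigDomainSeq L M₁ R k Ω) (hL : 0 < L)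
    (hM₁ : 0 < M₁) {j : ℕ} {x : Pt d} (hx : x ∈ layer Ω j) :
    IsClassCubeB9 L M₁ k Ω j (corner (M₁ * L ^ j) x) 1 ∧ x ∈ cbox (corner (M₁ * L ^ j) x) ((1 * (M₁ * L ^ j) : ℕ) : ℤ) := by
  have hs : 0 < M₁ * L ^ j := Nat.mul_pos hM₁ (pow_pos hL j)
  have hbox : cbox (corner (M₁ * L ^ j) x) ((1 * (M₁ * L ^ j) : ℕ) : ℤ) = pcube (M₁ * L ^ j) (cubeIdx (M₁ * L ^ j) x) := by
    rw [one_mul, pcube_eq_cbox _ hs]; rfl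
  have hxbox : x ∈ cbox (corner (M₁ * L ^ j) x) ((1 * (M₁ * L ^ j) : ℕ) : ℤ) := by
    rw [hbox]; rfl
  -- the whole block lies in the layer
  have hsub : cbox (corner (M₁ * L ^ j) x) ((1 * (M₁ * L ^ j) : ℕ) : ℤ) ⊆ layer Ω j := by
    rw [hbox]
    intro y hy
    have hidx : cubeIdx (M₁ * L ^ j) y = cubeIdx (M₁ * L ^ j) x := hy
    refine ⟨(hΩ.cubes j y x hidx).mpr hx.1, fun hy1 => hx.2 ?_⟩
    exact (hΩ.cubes_le (Nat.le_succ j) y x hidx).mp hy1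
  refine ⟨⟨hΩ.le_of_mem hx.1, le_rfl, by norm_num, fun i => dvd_corner _ x i, ?_, ⟨x, hxbox, hx⟩⟩, hxbox⟩
  intro y hy
  have hyl := hsub hy
  exact ⟨hyl.1, fun hy2 => hyl.2 (hΩ.anti (j + 1) hy2)⟩

/-! ## §4 The [B11] class of cubes (p. 279) and the covering lemma -/

/-- **THE [B11] CLASS OF CUBES, pp. 278–279** (fine units): a cube of INDEX `j ≤ k` with CENTRE `c` on the
`M₁L^j`-lattice and SIZE PARAMETER `M`, `□ = ccube c (M·L^j)` (*"□ has a size 2ML^jη, where M is a multiple of R₁M₁"*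
— so `□` is a union of big blocks), whose enlargement `□̃ = ccube c ((M + 2R₁M₁)·L^j)` (*"the cube □̃ of the size
(2M + 4R₁M₁)L^jη and with the same center as □"*) *"is contained in B^j(Λ_j) ∪ B^{j+1}(Λ_{j+1})"* (`= Ω_j ∖ Ω_{j+2}`)
*"but not in B^{j+1}(Λ_{j+1})"* (given the first clause: `□̃ ⊄ Ω_{j+1}`).  Typed READING of [Balaban1985Variational]
pp. 278–279 (the class of cubes); hypothesis shape, asserted of nothing. [folklore] -/
structure IsClassCubeB11 (L M₁ R₁ k : ℕ) (Ω : ℕ → Set (Pt d)) (j : ℕ) (c : Pt d) (M : ℕ) : Prop where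
  /-- the index is at most `k` -/
  index_le : j ≤ k
  /-- `M` is a (positive) multiple of `R₁M₁` -/
  size_dvd : R₁ * M₁ ∣ M
  /-- `0 < M` -/
  size_pos : 0 < M
  /-- the centre lies on the big-block lattice of level `j` -/
  centre_dvd : ∀ i, ((M₁ * L ^ j : ℕ) : ℤ) ∣ c i
  /-- `□̃ ⊂ Ω_j ∖ Ω_{j+2}` -/
  enl_subset : ccube c (((M + 2 * (R₁ * M₁)) * L ^ j : ℕ) : ℤ) ⊆ Ω j \ Ω (j + 2)
  /-- `□̃ ⊄ B^{j+1}(Λ_{j+1})`, i.e. `□̃ ⊄ Ω_{j+1}` -/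
  not_subset : ¬ ccube c (((M + 2 * (R₁ * M₁)) * L ^ j : ℕ) : ℤ) ⊆ Ω (j + 1)

namespace IsClassCubeB11

variable {L M₁ R₁ k : ℕ} {Ω : ℕ → Set (Pt d)} {j : ℕ} {c : Pt d} {M : ℕ}

/-- The cube itself: `□ = ccube c (M L^j) ⊆ □̃`. [folklore] -/
theorem cube_subset_enl (_h : IsClassCubeB11 L M₁ R₁ k Ω j c M) :
    ccube c ((M * L ^ j : ℕ) : ℤ) ⊆ ccube c (((M + 2 * (R₁ * M₁)) * L ^ j : ℕ) : ℤ) :=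
  ccube_mono c (by
    push_cast
    have h1 : (0 : ℤ) ≤ 2 * ((R₁ : ℤ) * M₁) * (L : ℤ) ^ j := by positivity
    nlinarith [h1])

/-- `□ ⊆ Ω_j ∖ Ω_{j+2}`. [folklore] -/
theorem cube_subset (h : IsClassCubeB11 L M₁ R₁ k Ω j c M) : ccube c ((M * L ^ j : ℕ) : ℤ) ⊆ Ω j \ Ω (j + 2) :=
  (h.cube_subset_enl).trans h.enl_subset

/-- `□̃` meets the layer `Ω_j ∖ Ω_{j+1} = B^j(Λ_j)` (the [B9]-type clause follows from the [B11] clauses). [folklore] -/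
theorem enl_meets_layer (h : IsClassCubeB11 L M₁ R₁ k Ω j c M) :
    (ccube c (((M + 2 * (R₁ * M₁)) * L ^ j : ℕ) : ℤ) ∩ layer Ω j).Nonempty := by
  by_contra hne
  rw [Set.not_nonempty_iff_eq_empty] at hne
  apply h.not_subset
  intro y hy
  by_contra hy1
  have : y ∈ ccube c (((M + 2 * (R₁ * M₁)) * L ^ j : ℕ) : ℤ) ∩ layer Ω j := ⟨hy, (h.enl_subset hy).1, hy1⟩
  rw [hne] at this
  exact this

end IsClassCubeB11

section Cover

variable {L M₁ R R₁ k : ℕ} {Ω : ℕ → Set (Pt d)}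

/-- Sup-distance from a point with corner bounds `0 ≤ x_i − c_i < s` to a point of `ccube c h`: at most `h + s`.
[folklore] -/
theorem within_of_corner_of_mem_ccube {c x y : Pt d} {h s : ℤ} (hx : ∀ i, 0 ≤ x i - c i ∧ x i - c i < s)
    (hy : y ∈ ccube c h) : Within (h + s) x y := fun i => by
  obtain ⟨h1, h2⟩ := hx i
  obtain ⟨h3, h4⟩ := hy i
  rw [abs_le]; constructor <;> linarith

/-- A point with corner bounds `0 ≤ x_i − c_i < s ≤ h` lies in `ccube c h`. [folklore] -/
theorem mem_ccube_of_corner {c x : Pt d} {h s : ℤ} (hx : ∀ i, 0 ≤ x i - c i ∧ x i - c i < s) (hs : s ≤ h) :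
    x ∈ ccube c h := fun i => by
  obtain ⟨h1, h2⟩ := hx i
  exact ⟨by linarith, by linarith⟩

/-- Arithmetic of the interior regime: `4R₁ + 1 ≤ R·L` under `12(R₁+1)L ≤ R`, `1 ≤ L`. [folklore] -/
theorem coefA_le (hL : 1 ≤ L) (hR : 12 * (R₁ + 1) * L ≤ R) : ((4 * R₁ + 1 : ℕ) : ℤ) ≤ (R : ℤ) * L := by
  have h : 4 * R₁ + 1 ≤ R * L := by nlinarith
  exact_mod_cast h

/-- Arithmetic of the collar regime: `(5L+2)R₁ + 1 ≤ R` and `(4R₁+1)L + (5L+2)R₁ + 1 ≤ R·L` under `12(R₁+1)L ≤ R`,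
`1 ≤ L`. [folklore] -/
theorem coefB_le (hL : 1 ≤ L) (hR : 12 * (R₁ + 1) * L ≤ R) :
    (((5 * L + 2) * R₁ + 1 : ℕ) : ℤ) ≤ (R : ℤ) ∧
      (((4 * R₁ + 1) * L + ((5 * L + 2) * R₁ + 1) : ℕ) : ℤ) ≤ (R : ℤ) * L := by
  have h1 : (5 * L + 2) * R₁ + 1 ≤ R := by nlinarith
  have h2 : (4 * R₁ + 1) * L + ((5 * L + 2) * R₁ + 1) ≤ R * L := by nlinarith
  exact ⟨by exact_mod_cast h1, by exact_mod_cast h2⟩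

/-- **INTERIOR REGIME.**  If `x ∈ Ω_j ∖ Ω_{j+1}` and the enlargement (half-side `4R₁M₁L^j`) of the cube of size
parameter `2R₁M₁` about the corner `c` of `x`'s big block FITS IN `Ω_j`, then `(j, c, 2R₁M₁)` is a [B11] class cube and
`x` lies `M₁L^j`-deep in it. [folklore] -/
theorem interior_classCubeB11 (hΩ : BigDomainSeq L M₁ R k Ω) (hL : 1 ≤ L) (hM₁ : 1 ≤ M₁) (hR₁ : 1 ≤ R₁)
    (hR : 12 * (R₁ + 1) * L ≤ R) {j : ℕ} {x : Pt d} (hx : x ∈ layer Ω j)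
    (hA : ccube (corner (M₁ * L ^ j) x) (((4 * (R₁ * M₁)) * L ^ j : ℕ) : ℤ) ⊆ Ω j) :
    IsClassCubeB11 L M₁ R₁ k Ω j (corner (M₁ * L ^ j) x) (2 * (R₁ * M₁)) ∧
      ∀ y, Within ((M₁ * L ^ j : ℕ) : ℤ) x y →
        y ∈ ccube (corner (M₁ * L ^ j) x) (((2 * (R₁ * M₁)) * L ^ j : ℕ) : ℤ) := by
  have hs : 0 < M₁ * L ^ j := Nat.mul_pos hM₁ (pow_pos hL j)
  set c := corner (M₁ * L ^ j) x with hc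
  -- the unit `u = M₁ L^j`, its multiples, and the corner bounds of `x`
  set u : ℤ := ((M₁ * L ^ j : ℕ) : ℤ) with hu
  have hu0 : (0 : ℤ) ≤ u := by positivity
  have hxc : ∀ i, 0 ≤ x i - c i ∧ x i - c i < u := fun i => corner_le_lt _ hs x i
  have e4 : (((4 * (R₁ * M₁)) * L ^ j : ℕ) : ℤ) = 4 * (R₁ : ℤ) * u := by rw [hu]; push_cast; ring
  have e2 : (((2 * (R₁ * M₁)) * L ^ j : ℕ) : ℤ) = 2 * (R₁ : ℤ) * u := by rw [hu]; push_cast; ring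
  have eM : (((2 * (R₁ * M₁) + 2 * (R₁ * M₁)) * L ^ j : ℕ) : ℤ) = 4 * (R₁ : ℤ) * u := by rw [hu]; push_cast; ring
  have hR₁' : (1 : ℤ) ≤ R₁ := by exact_mod_cast hR₁
  have hRu : u ≤ (R₁ : ℤ) * u := le_mul_of_one_le_left hu0 hR₁'
  -- `x ∈ □̃`
  have hxE : x ∈ ccube c (4 * (R₁ : ℤ) * u) :=
    mem_ccube_of_corner hxc (by nlinarith)
  refine ⟨⟨hΩ.le_of_mem hx.1, Dvd.intro_left _ rfl, by positivity, fun i => dvd_corner _ x i, ?_, ?_⟩, ?_⟩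
  · -- `□̃ ⊆ Ω_j ∖ Ω_{j+2}`
    rw [eM]
    intro y hy
    refine ⟨hA (by rw [e4]; exact hy), fun hy2 => hx.2 ?_⟩
    -- `y ∈ Ω_{j+2}` would put `x`, within `(4R₁+1)u ≤ R M₁ L^{j+1}` of `y`, into `Ω_{j+1}`
    refine hΩ.sep (j + 1) y hy2 x ?_
    have hw : Within (4 * (R₁ : ℤ) * u + u) x y := within_of_corner_of_mem_ccube hxc hy
    have hcoef := coefA_le (R₁ := R₁) hL hR
    refine (hw.symm).mono ?_
    have : ((4 * R₁ + 1 : ℕ) : ℤ) * u ≤ (R : ℤ) * L * u := mul_le_mul_of_nonneg_right hcoef hu0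
    have e : ((R : ℤ) * M₁ * L ^ (j + 1)) = (R : ℤ) * L * u := by rw [hu]; push_cast; ring
    rw [e]
    push_cast at this
    linarith
  · -- `□̃ ⊄ Ω_{j+1}`: it contains `x ∉ Ω_{j+1}`
    rw [eM]
    exact fun hsub => hx.2 (hsub hxE)
  · -- depth `u`
    intro y hy
    rw [e2]
    refine mem_ccube_of_within (t := u) (fun i => ⟨?_, ?_⟩) hy
    · linarith [(hxc i).1]
    · linarith [(hxc i).2]

/-- **COLLAR REGIME.**  If `x ∈ Ω_{j+1} ∖ Ω_{j+2}` but the enlargement of its natural index-`(j+1)` cube does NOT fit in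
`Ω_{j+1}` (a point `z ∉ Ω_{j+1}` lies in it), then the cube of the LOWER index `j` about the corner `c′` of `x`'s
level-`j` big block with the size parameter `5L·R₁M₁` is a [B11] class cube (its enlargement contains `z`, hence is
«not contained in B^{j+1}(Λ_{j+1})», lies in `Ω_j` by the separation at level `j`, and misses `Ω_{j+2}` by the
separation at level `j+1`), and `x` lies `M₁L^j`-deep in it. [folklore] -/
theorem collar_classCubeB11 (hΩ : BigDomainSeq L M₁ R k Ω) (hL : 1 ≤ L) (hM₁ : 1 ≤ M₁) (hR₁ : 1 ≤ R₁)
    (hR : 12 * (R₁ + 1) * L ≤ R) {j : ℕ} {x : Pt d} (hx : x ∈ layer Ω (j + 1)) {z : Pt d}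
    (hz : z ∈ ccube (corner (M₁ * L ^ (j + 1)) x) (((4 * (R₁ * M₁)) * L ^ (j + 1) : ℕ) : ℤ)) (hzΩ : z ∉ Ω (j + 1)) :
    IsClassCubeB11 L M₁ R₁ k Ω j (corner (M₁ * L ^ j) x) (5 * L * (R₁ * M₁)) ∧
      ∀ y, Within ((M₁ * L ^ j : ℕ) : ℤ) x y →
        y ∈ ccube (corner (M₁ * L ^ j) x) (((5 * L * (R₁ * M₁)) * L ^ j : ℕ) : ℤ) := by
  have hs : 0 < M₁ * L ^ j := Nat.mul_pos hM₁ (pow_pos hL j)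
  have hs1 : 0 < M₁ * L ^ (j + 1) := Nat.mul_pos hM₁ (pow_pos hL (j + 1))
  set c := corner (M₁ * L ^ j) x with hc
  set c₀ := corner (M₁ * L ^ (j + 1)) x with hc₀
  set u : ℤ := ((M₁ * L ^ j : ℕ) : ℤ) with hu
  have hu0 : (0 : ℤ) ≤ u := by positivity
  have hxc : ∀ i, 0 ≤ x i - c i ∧ x i - c i < u := fun i => corner_le_lt _ hs x i
  have hxc₀ : ∀ i, 0 ≤ x i - c₀ i ∧ x i - c₀ i < (L : ℤ) * u := by
    intro i
    have h := corner_le_lt _ hs1 x i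
    have e : (((M₁ * L ^ (j + 1) : ℕ)) : ℤ) = (L : ℤ) * u := by rw [hu]; push_cast; ring
    rw [e] at h
    exact h
  have e4 : (((4 * (R₁ * M₁)) * L ^ (j + 1) : ℕ) : ℤ) = 4 * (R₁ : ℤ) * L * u := by rw [hu]; push_cast; ring
  have e5 : (((5 * L * (R₁ * M₁)) * L ^ j : ℕ) : ℤ) = 5 * (L : ℤ) * R₁ * u := by rw [hu]; push_cast; ring
  have eM : (((5 * L * (R₁ * M₁) + 2 * (R₁ * M₁)) * L ^ j : ℕ) : ℤ) = (5 * (L : ℤ) + 2) * R₁ * u := by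
    rw [hu]; push_cast; ring
  have hR₁' : (1 : ℤ) ≤ R₁ := by exact_mod_cast hR₁
  have hL' : (1 : ℤ) ≤ L := by exact_mod_cast hL
  have hRu : u ≤ (R₁ : ℤ) * u := le_mul_of_one_le_left hu0 hR₁'
  have hLu : u ≤ (L : ℤ) * u := le_mul_of_one_le_left hu0 hL'
  have hRLu : (L : ℤ) * u ≤ (R₁ : ℤ) * ((L : ℤ) * u) := le_mul_of_one_le_left (by positivity) hR₁'
  rw [e4] at hz
  obtain ⟨hB1, hB2⟩ := coefB_le (R₁ := R₁) hL hR
  have hB1u : (((5 * L + 2) * R₁ + 1 : ℕ) : ℤ) * u ≤ (R : ℤ) * u := mul_le_mul_of_nonneg_right hB1 hu0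
  have hB2u : (((4 * R₁ + 1) * L + ((5 * L + 2) * R₁ + 1) : ℕ) : ℤ) * u ≤ (R : ℤ) * L * u :=
    mul_le_mul_of_nonneg_right hB2 hu0
  push_cast at hB1u hB2u
  -- `x` is `((5L+2)R₁+1)u`-close to every point of `□̃`
  have hxE : ∀ y, y ∈ ccube c ((5 * (L : ℤ) + 2) * R₁ * u) → Within ((5 * (L : ℤ) + 2) * R₁ * u + u) x y :=
    fun y hy => within_of_corner_of_mem_ccube hxc hy
  -- `x` is `(4R₁+1)Lu`-close to `z`
  have hxz : Within (4 * (R₁ : ℤ) * L * u + L * u) x z := within_of_corner_of_mem_ccube hxc₀ hz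
  -- `z ∈ □̃`
  have hzE : z ∈ ccube c ((5 * (L : ℤ) + 2) * R₁ * u) := by
    intro i
    obtain ⟨hz1, hz2⟩ := hz i
    obtain ⟨hx1, hx2⟩ := hxc₀ i
    obtain ⟨hx3, hx4⟩ := hxc i
    constructor <;> nlinarith
  have hjk : j ≤ k := by have := hΩ.le_of_mem hx.1; omega
  refine ⟨⟨hjk, Dvd.intro_left _ rfl, by positivity, fun i => dvd_corner _ x i, ?_, ?_⟩, ?_⟩
  · -- `□̃ ⊆ Ω_j ∖ Ω_{j+2}`
    rw [eM]
    intro y hy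
    constructor
    · -- in `Ω_j`: `x ∈ Ω_{j+1}` and `y` is within `R M₁ L^j` of `x`
      refine hΩ.sep j x hx.1 y ((hxE y hy).mono ?_)
      have e : ((R : ℤ) * M₁ * L ^ j) = (R : ℤ) * u := by rw [hu]; push_cast; ring
      rw [e]; linarith
    · -- not in `Ω_{j+2}`: else `z`, within `R M₁ L^{j+1}` of `y`, would be in `Ω_{j+1}`
      intro hy2
      refine hzΩ (hΩ.sep (j + 1) y hy2 z ?_)
      have hw : Within (((5 * (L : ℤ) + 2) * R₁ * u + u) + (4 * (R₁ : ℤ) * L * u + L * u)) y z :=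
        (hxE y hy).symm.triangle hxz
      refine hw.mono ?_
      have e : ((R : ℤ) * M₁ * L ^ (j + 1)) = (R : ℤ) * L * u := by rw [hu]; push_cast; ring
      rw [e]; linarith
  · -- `□̃ ⊄ Ω_{j+1}`: it contains `z`
    rw [eM]
    exact fun hsub => hzΩ (hsub hzE)
  · -- depth `u`
    intro y hy
    rw [e5]
    refine mem_ccube_of_within (t := u) (fun i => ⟨?_, ?_⟩) hy
    · nlinarith [(hxc i).1]
    · nlinarith [(hxc i).2]

end Cover


/-! ## §3′ (v1.1) The [B9] class of cubes WITH THE PRINTED BLOCK COUNT «O(1) ≧ 10» -/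

/-- **THE [B9] CLASS OF CUBES, p. 396, AS PRINTED** (v1.1; supersedes `IsClassCubeB9`, whose block count `≤ 10` came from the OCR layer —
XREAD F-ne9leaf09g10-1, render `…p008-x2.png`: *"Here O(1) will mean a number ≧ 10"*; p. 409: *"the number O(1) in the condition
(3.35) can be taken as equal to 12"*): a cube of INDEX `j ≤ k`, lower corner `a` on the `M₁L^j`-lattice, side `nblk·M₁L^j` with
`nblk ≥ 10` big blocks, `□ ⊂ B^j(Λ_j) ∪ B^{j+1}(Λ_{j+1}) = Ω_j ∖ Ω_{j+2}`, `□ ∩ B^j(Λ_j) ≠ ∅`.  Hypothesis shape on data, asserted of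
nothing (the special reading of `Λ₀` on p. 396 is not typed). [folklore] -/
structure IsClassCube396 (L M₁ k : ℕ) (Ω : ℕ → Set (Pt d)) (j : ℕ) (a : Pt d) (nblk : ℕ) : Prop where
  /-- the index is at most `k` -/
  index_le : j ≤ k
  /-- at least ten big blocks per side: the printed «O(1) ≧ 10» -/
  ten_le : 10 ≤ nblk
  /-- the corner lies on the big-block lattice of level `j` -/
  corner_dvd : ∀ i, ((M₁ * L ^ j : ℕ) : ℤ) ∣ a i
  /-- `□ ⊂ B^j(Λ_j) ∪ B^{j+1}(Λ_{j+1}) = Ω_j ∖ Ω_{j+2}` -/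
  subset : cbox a ((nblk * (M₁ * L ^ j) : ℕ) : ℤ) ⊆ Ω j \ Ω (j + 2)
  /-- `□ ∩ B^j(Λ_j) ≠ ∅` -/
  meets : (cbox a ((nblk * (M₁ * L ^ j) : ℕ) : ℤ) ∩ layer Ω j).Nonempty

/-- **UNIQUENESS OF THE INDEX for the printed class** (p. 396 *"there exists a unique index j"*; as v1's proof). [folklore] -/
theorem IsClassCube396.index_unique {L M₁ R k : ℕ} {Ω : ℕ → Set (Pt d)} (hΩ : BigDomainSeq L M₁ R k Ω)
    {j j' : ℕ} {a a' : Pt d} {n n' : ℕ} (hc : IsClassCube396 L M₁ k Ω j a n) (hc' : IsClassCube396 L M₁ k Ω j' a' n')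
    (heq : cbox a ((n * (M₁ * L ^ j) : ℕ) : ℤ) = cbox a' ((n' * (M₁ * L ^ j') : ℕ) : ℤ)) : j = j' := by
  by_contra hne
  rcases Nat.lt_or_gt_of_ne hne with hlt | hlt
  · obtain ⟨y, hy, hyl⟩ := hc.meets
    have hy' : y ∈ Ω j' := by
      rw [heq] at hy
      exact (hc'.subset hy).1
    exact hyl.2 (hΩ.anti_le (Nat.succ_le_of_lt hlt) hy')
  · obtain ⟨y, hy, hyl⟩ := hc'.meets
    have hy' : y ∈ Ω j := by
      rw [← heq] at hy
      exact (hc.subset hy).1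
    exact hyl.2 (hΩ.anti_le (Nat.succ_le_of_lt hlt) hy')

attribute [deprecated IsClassCube396 (since := "2026-08-20")] IsClassCubeB9
attribute [deprecated IsClassCube396.index_unique (since := "2026-08-20")] IsClassCubeB9.index_unique
attribute [deprecated "withdrawn v1.1: one block is not a printed class cube (O(1) ≧ 10)" (since := "2026-08-20")]
  bigBlock_isClassCubeB9

end Summit.QuantumFields.BalabanUV.T4Continuum.SmallFieldDomains
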